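import Mathlib
import Literature.MathematicalPhysics.KineticTheory.FluctuationAbelPositivity
import Literature.MathematicalPhysics.KineticTheory.ZeroWavenumberSpace
import Summits.AtomisticToContinuum.FouriersLaw.Theorems.EmbeddedDrudeMourreMourreDissolutionAbelVariational
import HarnessLib

/-!
# `EmbeddedDrudeMourre.MourreDissolution`, line `separable-vertex-faddeev-pair-sector` —
# helpers for stub `stub_fgrPositivity` (part 2/3): Abel floors from trial vectors on `ℋ₀`

Item `stmt-AtomisticToContinuum-12594` (crux `MourreDissolution` of route `EmbeddedDrudeMourre`,
sub-problem `FouriersLaw`), registered stub `stub_fgrPositivity` (S7) of the line skeleton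
`Cruxes/MourreDissolution/Lines/separable_vertex_faddeev_pair_sector.lean`.

The abstract duality of part 1/3 (`…AbelVariational`: for a unitary group with generator `A`,
`∫₀^∞ e^{-νt} Re⟪v, U(t)v⟫ dt = max_{φ ∈ D(A)} {2Re⟪v,φ⟫ - ν‖φ‖² - ν⁻¹‖Aφ‖²}`) is transferred

* §1 to the real (orthogonal) Koopman group `U_t` of a strongly continuous `FluctuationDynamics`
  with real generator `L` (through the complexification `F.unitaryGroup h`, whose Stone generator is
  `L ⊕ L` on `D(𝓛) = D(L)_ℂ`: `liouvillean_ofReal`, `liouvillean_apply_eq`): the inequality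
  `variational_le_…`, ATTAINMENT `exists_variational_eq_…` (the real part of the complex maximiser
  does at least as well), the supremum form `le_integral_exp_neg_mul_inner_koopman_iff`, the Jensen
  form `ν⟪ψ,φ⟫²/(ν²‖φ‖² + ‖Lφ‖²) ≤ 𝒜(ν)` and MAZUR's inequality in Abel form `𝖣_ψ/ν ≤ 𝒜(ν)`;
* §2 to Doyon's zero-wavenumber space `ℋ₀(μ)` of the chain (`Z : ZeroWavenumberData P D` with
  momentum reversal, `C_μ = D.currentCorrelation Z.μ = ⟪[J], U_t[J]⟫₀`, `𝓛♮ = Z.generator`):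
  `2⟪[J],φ⟫₀ - ν‖φ‖₀² - ν⁻¹‖𝓛♮φ‖₀² ≤ A_μ(ν) := ∫₀^∞ e^{-νt} C_μ(t) dt` with equality for some
  `φ ∈ D(𝓛♮)`, hence the **equivalence of the uniform Abel floor of Stub 7 with the existence of
  trial vectors** (`ZeroWavenumberData.abelFunctional_floor_iff_trialVectors`):
  `(∀ ν ∈ (0,ν₀), c ≤ A_μ(ν)) ↔ (∀ ν ∈ (0,ν₀), ∃ φ_ν ∈ D(𝓛♮), c ≤ 2⟪[J],φ_ν⟫₀ - ν‖φ_ν‖₀² - ν⁻¹‖𝓛♮φ_ν‖₀²)`.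

So the physical content of Stub 7 (the Fermi-golden-rule VALUE of the Green–Kubo plateau) is
EXACTLY the construction, for the Gibbs state of `pinnedChain` at small `T`, of approximate
zero-modes `φ_ν` of `𝓛♮` at scale `ν` overlapping `[J]` ("all-orders dressed odd charges"); the
Mazur floor shows the statement is trivial when the Drude weight `𝖣_J > 0`, so its content is in
the atom-free case. Sources: Mazur 1969; Sethuraman–Varadhan–Yau 2000; Komorowski–Landim–Olla 2012
Ch. 2. All proofs tagged `[folklore]`.
-/

noncomputable section

namespace Summit.AtomisticToContinuum.FouriersLaw.Theorems.MourreDissolution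

open Filter Topology MeasureTheory Set
open scoped InnerProductSpace
open Literature.MathematicalPhysics.KineticTheory.HeatConduction
open Literature.MathematicalPhysics.KineticTheory
open Literature.Analysis.UnboundedOperators

/-! ### §1. The real Koopman group of a strongly continuous fluctuation dynamics -/

section RealFluctuation

variable {G Ω : Type*} [AddCommGroup G] [MeasurableSpace G] [MeasurableSpace Ω]
  {ν₀ : Measure G} {T : ShiftAction G Ω} [MeasurableNeg G] [ν₀.IsNegInvariant]

/-- On `D(𝓛) = D(A)` of the complexified group, `re u ∈ D(L)`, `im u ∈ D(L)` and the generator is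
`A u = L(re u) + i L(im u)` (`𝓛 = -iA`, `liouvillean_apply_eq`). [folklore] -/
theorem _root_.Literature.MathematicalPhysics.KineticTheory.FluctuationDynamics.IsStronglyContinuous.generator_unitaryGroup_eq
    {F : FluctuationDynamics ν₀ T} (h : F.IsStronglyContinuous)
    (u : (OneParameterGroup.generator (F.unitaryGroup h).toStrongContRepresentation).domain) :
    ∃ (hre : (u : F.ComplexFluctuationSpace).re ∈ F.generatorDomain)
      (him : (u : F.ComplexFluctuationSpace).im ∈ F.generatorDomain),
      (OneParameterGroup.generator (F.unitaryGroup h).toStrongContRepresentation u :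
          F.ComplexFluctuationSpace) =
        ⟨F.generator ⟨_, hre⟩, F.generator ⟨_, him⟩⟩ := by
  obtain ⟨u, hu⟩ := u
  have hdom : u ∈ (F.liouvillean h).domain := hu
  refine ⟨F.re_mem_generatorDomain_of_mem_liouvillean_domain h hdom,
    F.im_mem_generatorDomain_of_mem_liouvillean_domain h hdom, ?_⟩
  have hval := F.liouvillean_apply_eq h ⟨u, hdom⟩
  change (F.unitaryGroup h).hamiltonian ⟨u, hdom⟩ = _ at hval
  rw [UnitaryRep.hamiltonian_apply] at hval
  exact smul_right_injective _ (neg_ne_zero.2 Complex.I_ne_zero) hval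

/-- **Variational lower bound, real (orthogonal) Koopman group of a strongly continuous fluctuation
dynamics**: for `ψ ∈ ℋ`, `φ` in the domain of the real generator `L` and `ν > 0`,
`2⟪ψ, φ⟫ - ν‖φ‖² - ν⁻¹‖Lφ‖² ≤ ∫₀^∞ e^{-νt} ⟪ψ, U_t ψ⟫ dt` (transfer of the complex statement
through the complexification `F.unitaryGroup h`, whose Stone generator extends `L`:
`FluctuationDynamics.liouvillean_ofReal`). [folklore] -/
theorem _root_.Literature.MathematicalPhysics.KineticTheory.FluctuationDynamics.IsStronglyContinuous.variational_le_integral_exp_neg_mul_inner_koopman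
    {F : FluctuationDynamics ν₀ T} (h : F.IsStronglyContinuous) {ν : ℝ} (hν : 0 < ν)
    (ψ : F.FluctuationSpace) (φ : F.generatorDomain) :
    2 * ⟪ψ, (φ : F.FluctuationSpace)⟫_ℝ - ν * ‖(φ : F.FluctuationSpace)‖ ^ 2
        - ν⁻¹ * ‖F.generator φ‖ ^ 2 ≤
      ∫ t in Ioi (0 : ℝ), Real.exp (-(ν * t)) * ⟪ψ, F.koopman t ψ⟫_ℝ := by
  obtain ⟨hφ, hval⟩ := F.liouvillean_ofReal h φ
  have hA : (OneParameterGroup.generator (F.unitaryGroup h).toStrongContRepresentation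
      ⟨Complexification.ofReal (φ : F.FluctuationSpace), hφ⟩ : F.ComplexFluctuationSpace) =
      Complexification.ofReal (F.generator φ) := by
    change (F.unitaryGroup h).hamiltonian ⟨_, hφ⟩ = _ at hval
    rw [UnitaryRep.hamiltonian_apply] at hval
    exact smul_right_injective _ (neg_ne_zero.2 Complex.I_ne_zero) hval
  have key := (F.unitaryGroup h).variational_le_integral_exp_neg_mul_re_inner_appReal hν
    (Complexification.ofReal ψ) ⟨Complexification.ofReal (φ : F.FluctuationSpace), hφ⟩
  have e1 : ((⟨Complexification.ofReal (φ : F.FluctuationSpace), hφ⟩ :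
      (OneParameterGroup.generator (F.unitaryGroup h).toStrongContRepresentation).domain) :
      F.ComplexFluctuationSpace) = Complexification.ofReal (φ : F.FluctuationSpace) := rfl
  simp_rw [F.inner_koopman_eq_re_inner_unitaryGroup h]
  rw [e1, hA, Complexification.inner_ofReal_ofReal, Complex.ofReal_re,
    LinearIsometry.norm_map, LinearIsometry.norm_map] at key
  exact key

/-- **The real variational bound is attained**: for `ψ ∈ ℋ` and `ν > 0` there is `φ ∈ D(L)` with
`2⟪ψ, φ⟫ - ν‖φ‖² - ν⁻¹‖Lφ‖² = ∫₀^∞ e^{-νt} ⟪ψ, U_t ψ⟫ dt`: the real part `re u` of the complex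
maximiser `u` of part 1/3 (for `v = ψ + i0`) does at least as well as `u`, since
`Re⟪ψ + i0, u⟫ = ⟪ψ, re u⟫`, `‖re u‖ ≤ ‖u‖` and `‖L(re u)‖ ≤ ‖Au‖` (`Au = L(re u) + iL(im u)`).
(In fact `u` is real, `u = ν(ν² - L²)⁻¹ψ + i0`, which is not needed.) [folklore] -/
theorem _root_.Literature.MathematicalPhysics.KineticTheory.FluctuationDynamics.IsStronglyContinuous.exists_variational_eq_integral_exp_neg_mul_inner_koopman
    {F : FluctuationDynamics ν₀ T} (h : F.IsStronglyContinuous) {ν : ℝ} (hν : 0 < ν)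
    (ψ : F.FluctuationSpace) :
    ∃ φ : F.generatorDomain,
      2 * ⟪ψ, (φ : F.FluctuationSpace)⟫_ℝ - ν * ‖(φ : F.FluctuationSpace)‖ ^ 2
          - ν⁻¹ * ‖F.generator φ‖ ^ 2 =
        ∫ t in Ioi (0 : ℝ), Real.exp (-(ν * t)) * ⟪ψ, F.koopman t ψ⟫_ℝ := by
  obtain ⟨u, hu⟩ := (F.unitaryGroup h).exists_variational_eq_integral_exp_neg_mul_re_inner_appReal
    hν (Complexification.ofReal ψ)
  obtain ⟨hre, him, hA⟩ := h.generator_unitaryGroup_eq u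
  refine ⟨⟨_, hre⟩, le_antisymm (h.variational_le_integral_exp_neg_mul_inner_koopman hν ψ ⟨_, hre⟩)
    ?_⟩
  simp_rw [F.inner_koopman_eq_re_inner_unitaryGroup h]
  rw [← hu, hA]
  have h1 : (⟪Complexification.ofReal ψ, (u : F.ComplexFluctuationSpace)⟫_ℂ).re =
      ⟪ψ, (u : F.ComplexFluctuationSpace).re⟫_ℝ := by
    rw [Complexification.inner_re, Complexification.ofReal_re, Complexification.ofReal_im,
      inner_zero_left, add_zero]
  have h2 : ‖(u : F.ComplexFluctuationSpace).re‖ ^ 2 ≤ ‖(u : F.ComplexFluctuationSpace)‖ ^ 2 := by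
    rw [Complexification.norm_sq]
    nlinarith [sq_nonneg ‖(u : F.ComplexFluctuationSpace).im‖]
  have h3 : ‖F.generator ⟨_, hre⟩‖ ^ 2 ≤
      ‖(⟨F.generator ⟨_, hre⟩, F.generator ⟨_, him⟩⟩ : F.ComplexFluctuationSpace)‖ ^ 2 := by
    rw [Complexification.norm_sq]
    nlinarith [sq_nonneg ‖F.generator ⟨_, him⟩‖]
  rw [h1]
  exact sub_le_sub (sub_le_sub_left (mul_le_mul_of_nonneg_left h2 hν.le) _)
    (mul_le_mul_of_nonneg_left h3 (inv_pos.2 hν).le)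

/-- **Supremum form of the real duality**: `c ≤ ∫₀^∞ e^{-νt} ⟪ψ, U_t ψ⟫ dt` iff some trial vector
`φ ∈ D(L)` has `c ≤ 2⟪ψ, φ⟫ - ν‖φ‖² - ν⁻¹‖Lφ‖²`. [folklore] -/
theorem _root_.Literature.MathematicalPhysics.KineticTheory.FluctuationDynamics.IsStronglyContinuous.le_integral_exp_neg_mul_inner_koopman_iff
    {F : FluctuationDynamics ν₀ T} (h : F.IsStronglyContinuous) {ν : ℝ} (hν : 0 < ν)
    (ψ : F.FluctuationSpace) (c : ℝ) :
    c ≤ ∫ t in Ioi (0 : ℝ), Real.exp (-(ν * t)) * ⟪ψ, F.koopman t ψ⟫_ℝ ↔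
      ∃ φ : F.generatorDomain,
        c ≤ 2 * ⟪ψ, (φ : F.FluctuationSpace)⟫_ℝ - ν * ‖(φ : F.FluctuationSpace)‖ ^ 2
          - ν⁻¹ * ‖F.generator φ‖ ^ 2 := by
  constructor
  · intro hc
    obtain ⟨φ, hφ⟩ := h.exists_variational_eq_integral_exp_neg_mul_inner_koopman hν ψ
    exact ⟨φ, hφ ▸ hc⟩
  · rintro ⟨φ, hφ⟩
    exact hφ.trans (h.variational_le_integral_exp_neg_mul_inner_koopman hν ψ φ)

/-- **Jensen form** of the variational bound (optimising over the scale of the trial vector):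
`ν⟪ψ, φ⟫²/(ν²‖φ‖² + ‖Lφ‖²) ≤ ∫₀^∞ e^{-νt} ⟪ψ, U_t ψ⟫ dt` for every `φ ∈ D(L)` (the left side is
the value of `s ↦ 2s⟪ψ,φ⟫ - s²(ν‖φ‖² + ν⁻¹‖Lφ‖²)` at its maximum; junk `0` when `φ = 0`). [folklore] -/
theorem _root_.Literature.MathematicalPhysics.KineticTheory.FluctuationDynamics.IsStronglyContinuous.jensen_le_integral_exp_neg_mul_inner_koopman
    {F : FluctuationDynamics ν₀ T} (h : F.IsStronglyContinuous) {ν : ℝ} (hν : 0 < ν)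
    (ψ : F.FluctuationSpace) (φ : F.generatorDomain) :
    ν * ⟪ψ, (φ : F.FluctuationSpace)⟫_ℝ ^ 2 /
        (ν ^ 2 * ‖(φ : F.FluctuationSpace)‖ ^ 2 + ‖F.generator φ‖ ^ 2) ≤
      ∫ t in Ioi (0 : ℝ), Real.exp (-(ν * t)) * ⟪ψ, F.koopman t ψ⟫_ℝ := by
  set a : ℝ := ⟪ψ, (φ : F.FluctuationSpace)⟫_ℝ with ha
  set d : ℝ := ν ^ 2 * ‖(φ : F.FluctuationSpace)‖ ^ 2 + ‖F.generator φ‖ ^ 2 with hd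
  rcases eq_or_ne d 0 with hd0 | hd0
  · rw [hd0, div_zero]
    exact h.integral_exp_neg_mul_inner_koopman_nonneg hν ψ
  · have hdpos : 0 < d := lt_of_le_of_ne (by positivity) (Ne.symm hd0)
    set s : ℝ := ν * a / d with hs
    have key := h.variational_le_integral_exp_neg_mul_inner_koopman hν ψ (s • φ)
    have hgen : F.generator (s • φ) = s • F.generator φ := LinearPMap.map_smul _ _ _
    rw [hgen, Submodule.coe_smul, real_inner_smul_right, norm_smul, norm_smul, Real.norm_eq_abs,
      mul_pow, mul_pow, sq_abs] at key
    have hbl : ν * ‖(φ : F.FluctuationSpace)‖ ^ 2 + ν⁻¹ * ‖F.generator φ‖ ^ 2 = d / ν := by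
      rw [hd]
      field_simp
    have hval : 2 * (s * a) - ν * (s ^ 2 * ‖(φ : F.FluctuationSpace)‖ ^ 2)
        - ν⁻¹ * (s ^ 2 * ‖F.generator φ‖ ^ 2) = ν * a ^ 2 / d := by
      calc 2 * (s * a) - ν * (s ^ 2 * ‖(φ : F.FluctuationSpace)‖ ^ 2)
            - ν⁻¹ * (s ^ 2 * ‖F.generator φ‖ ^ 2)
            = 2 * (s * a) - s ^ 2 * (ν * ‖(φ : F.FluctuationSpace)‖ ^ 2 + ν⁻¹ * ‖F.generator φ‖ ^ 2) := by
            ring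
        _ = 2 * (s * a) - s ^ 2 * (d / ν) := by rw [hbl]
        _ = ν * a ^ 2 / d := by
            rw [hs]
            field_simp
            ring
    rw [← ha, hval] at key
    exact key

/-- **Mazur's inequality in Abel form**: the Drude weight `𝖣_ψ = ‖P_{𝒬₀}ψ‖²` is a `1/ν` floor of
the Abel functional, `𝖣_ψ/ν ≤ ∫₀^∞ e^{-νt} ⟪ψ, U_t ψ⟫ dt` (trial vector `ν⁻¹ P_{𝒬₀}ψ`, which is
conserved: `L P_{𝒬₀}ψ = 0`). [folklore] -/
theorem _root_.Literature.MathematicalPhysics.KineticTheory.FluctuationDynamics.IsStronglyContinuous.drudeWeight_div_le_integral_exp_neg_mul_inner_koopman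
    {F : FluctuationDynamics ν₀ T} (h : F.IsStronglyContinuous) {ν : ℝ} (hν : 0 < ν)
    (ψ : F.FluctuationSpace) :
    F.drudeWeight ψ / ν ≤ ∫ t in Ioi (0 : ℝ), Real.exp (-(ν * t)) * ⟪ψ, F.koopman t ψ⟫_ℝ := by
  have hmem : F.hydroProjection ψ ∈ F.generatorDomain :=
    F.conservedSpace_le_generatorDomain (F.hydroProjection_mem ψ)
  set χ : F.generatorDomain := ⟨F.hydroProjection ψ, hmem⟩ with hχ
  have hL : F.generator χ = 0 :=
    F.generator_eq_zero_of_mem_conservedSpace (F.hydroProjection_mem ψ)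
  have hχv : (χ : F.FluctuationSpace) = F.hydroProjection ψ := rfl
  have key := h.variational_le_integral_exp_neg_mul_inner_koopman hν ψ (ν⁻¹ • χ)
  have hgen : F.generator (ν⁻¹ • χ) = ν⁻¹ • F.generator χ := LinearPMap.map_smul _ _ _
  rw [hgen, hL, smul_zero, norm_zero, Submodule.coe_smul, hχv, real_inner_smul_right,
    norm_smul, Real.norm_eq_abs, abs_of_pos (inv_pos.2 hν), ← F.drudeWeight_eq_inner, mul_pow,
    ← F.drudeWeight_def] at key
  have hval : 2 * (ν⁻¹ * F.drudeWeight ψ) - ν * (ν⁻¹ ^ 2 * F.drudeWeight ψ)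
      - ν⁻¹ * (0 : ℝ) ^ 2 = F.drudeWeight ψ / ν := by
    field_simp
    ring
  rw [hval] at key
  exact key

end RealFluctuation

/-! ### §2. The chain: Abel floors of `A_μ(ν) = ∫₀^∞ e^{-νt} C_μ(t) dt` from trial vectors in `ℋ₀` -/

section Chain

variable {P : OscillatorChain} {D : InfiniteChainDynamics P} (Z : ZeroWavenumberData P D)

/-- **Variational lower bound for the chain's Abel functional** `A_μ(ν) = ∫₀^∞ e^{-νt} C_μ(t) dt`
(`C_μ = D.currentCorrelation Z.μ = ⟪[J], U_t[J]⟫₀` under momentum reversal): for every `φ` in the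
domain of the generator `𝓛♮` of the Koopman group on `ℋ₀` and every `ν > 0`,
`2⟪[J], φ⟫₀ - ν‖φ‖₀² - ν⁻¹‖𝓛♮φ‖₀² ≤ A_μ(ν)`. This is the exact primal (Legendre) form of
`A_μ(ν) = ν⟪[J], (ν² - 𝓛♮²)⁻¹[J]⟫₀`; LOWER bounds on the Green–Kubo plateau are therefore
certified by trial vectors, with no time integration. [folklore] -/
theorem _root_.Literature.MathematicalPhysics.KineticTheory.HeatConduction.ZeroWavenumberData.variational_le_abelFunctional
    (hRev : Z.HasMomentumReversal)
    (hsc : ∀ ψ : ZeroWavenumberSpace Z, Continuous fun t : ℝ => Z.koopman t ψ) {ν : ℝ} (hν : 0 < ν)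
    (φ : ZeroWavenumberSpace Z) (hφ : φ ∈ Z.toFluctuationDynamics.generatorDomain) :
    2 * ⟪Z.currentClass, φ⟫_ℝ - ν * ‖φ‖ ^ 2 - ν⁻¹ * ‖Z.generator ⟨φ, hφ⟩‖ ^ 2 ≤
      ∫ t in Ioi (0 : ℝ), Real.exp (-(ν * t)) * D.currentCorrelation Z.μ t := by
  simp_rw [← Z.inner_currentClass_koopman_eq_currentCorrelation' hRev]
  exact FluctuationDynamics.IsStronglyContinuous.variational_le_integral_exp_neg_mul_inner_koopman
    (F := Z.toFluctuationDynamics) hsc hν Z.currentClass ⟨φ, hφ⟩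

/-- **Attainment for the chain**: for `ν > 0` some `φ ∈ D(𝓛♮)` realises
`2⟪[J], φ⟫₀ - ν‖φ‖₀² - ν⁻¹‖𝓛♮φ‖₀² = A_μ(ν)` (namely `φ = ν(ν² - 𝓛♮²)⁻¹[J]`). [folklore] -/
theorem _root_.Literature.MathematicalPhysics.KineticTheory.HeatConduction.ZeroWavenumberData.exists_variational_eq_abelFunctional
    (hRev : Z.HasMomentumReversal)
    (hsc : ∀ ψ : ZeroWavenumberSpace Z, Continuous fun t : ℝ => Z.koopman t ψ) {ν : ℝ} (hν : 0 < ν) :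
    ∃ (φ : ZeroWavenumberSpace Z) (hφ : φ ∈ Z.toFluctuationDynamics.generatorDomain),
      2 * ⟪Z.currentClass, φ⟫_ℝ - ν * ‖φ‖ ^ 2 - ν⁻¹ * ‖Z.generator ⟨φ, hφ⟩‖ ^ 2 =
        ∫ t in Ioi (0 : ℝ), Real.exp (-(ν * t)) * D.currentCorrelation Z.μ t := by
  simp_rw [← Z.inner_currentClass_koopman_eq_currentCorrelation' hRev]
  obtain ⟨⟨φ, hφ⟩, h⟩ :=
    FluctuationDynamics.IsStronglyContinuous.exists_variational_eq_integral_exp_neg_mul_inner_koopman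
      (F := Z.toFluctuationDynamics) hsc hν Z.currentClass
  exact ⟨φ, hφ, h⟩

/-- **The duality on `ℋ₀`, supremum form**: `c ≤ A_μ(ν)` iff some `φ ∈ D(𝓛♮)` has
`c ≤ 2⟪[J], φ⟫₀ - ν‖φ‖₀² - ν⁻¹‖𝓛♮φ‖₀²`. [folklore] -/
theorem _root_.Literature.MathematicalPhysics.KineticTheory.HeatConduction.ZeroWavenumberData.le_abelFunctional_iff
    (hRev : Z.HasMomentumReversal)
    (hsc : ∀ ψ : ZeroWavenumberSpace Z, Continuous fun t : ℝ => Z.koopman t ψ) {ν : ℝ} (hν : 0 < ν)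
    (c : ℝ) :
    c ≤ ∫ t in Ioi (0 : ℝ), Real.exp (-(ν * t)) * D.currentCorrelation Z.μ t ↔
      ∃ (φ : ZeroWavenumberSpace Z) (hφ : φ ∈ Z.toFluctuationDynamics.generatorDomain),
        c ≤ 2 * ⟪Z.currentClass, φ⟫_ℝ - ν * ‖φ‖ ^ 2 - ν⁻¹ * ‖Z.generator ⟨φ, hφ⟩‖ ^ 2 := by
  constructor
  · intro hc
    obtain ⟨φ, hφ, h⟩ := Z.exists_variational_eq_abelFunctional hRev hsc hν
    exact ⟨φ, hφ, h ▸ hc⟩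
  · rintro ⟨φ, hφ, h⟩
    exact h.trans (Z.variational_le_abelFunctional hRev hsc hν φ hφ)

/-- **Jensen form for the chain**: `ν⟪[J], φ⟫₀²/(ν²‖φ‖₀² + ‖𝓛♮φ‖₀²) ≤ A_μ(ν)` for every
`φ ∈ D(𝓛♮)`. In particular a UNIFORM floor `A_μ(ν) ≥ c > 0` as `ν ↓ 0` follows from unit trial
vectors `u_ν ∈ D(𝓛♮)` with `‖𝓛♮u_ν‖₀ ≤ κν` and `⟪[J], u_ν⟫₀² ≥ c(1 + κ²)ν` ("no pseudogap":
spectral weight `≳ ν` of `[J]` in `|ω| ≲ ν`). [folklore] -/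
theorem _root_.Literature.MathematicalPhysics.KineticTheory.HeatConduction.ZeroWavenumberData.jensen_le_abelFunctional
    (hRev : Z.HasMomentumReversal)
    (hsc : ∀ ψ : ZeroWavenumberSpace Z, Continuous fun t : ℝ => Z.koopman t ψ) {ν : ℝ} (hν : 0 < ν)
    (φ : ZeroWavenumberSpace Z) (hφ : φ ∈ Z.toFluctuationDynamics.generatorDomain) :
    ν * ⟪Z.currentClass, φ⟫_ℝ ^ 2 / (ν ^ 2 * ‖φ‖ ^ 2 + ‖Z.generator ⟨φ, hφ⟩‖ ^ 2) ≤
      ∫ t in Ioi (0 : ℝ), Real.exp (-(ν * t)) * D.currentCorrelation Z.μ t := by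
  simp_rw [← Z.inner_currentClass_koopman_eq_currentCorrelation' hRev]
  exact FluctuationDynamics.IsStronglyContinuous.jensen_le_integral_exp_neg_mul_inner_koopman
    (F := Z.toFluctuationDynamics) hsc hν Z.currentClass ⟨φ, hφ⟩

/-- **Mazur floor of the chain's Abel functional**: `𝖣_J/ν ≤ A_μ(ν)` with `𝖣_J = ‖P_{𝒬₀}[J]‖₀²`
the Drude weight of the current (`ZeroWavenumberData.currentDrudeWeight`). Hence a uniform Abel
floor holds trivially when `𝖣_J > 0`; its content is entirely in the atom-free case. [folklore] -/
theorem _root_.Literature.MathematicalPhysics.KineticTheory.HeatConduction.ZeroWavenumberData.currentDrudeWeight_div_le_abelFunctional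
    (hRev : Z.HasMomentumReversal)
    (hsc : ∀ ψ : ZeroWavenumberSpace Z, Continuous fun t : ℝ => Z.koopman t ψ) {ν : ℝ} (hν : 0 < ν) :
    Z.currentDrudeWeight / ν ≤
      ∫ t in Ioi (0 : ℝ), Real.exp (-(ν * t)) * D.currentCorrelation Z.μ t := by
  simp_rw [← Z.inner_currentClass_koopman_eq_currentCorrelation' hRev]
  exact FluctuationDynamics.IsStronglyContinuous.drudeWeight_div_le_integral_exp_neg_mul_inner_koopman
    (F := Z.toFluctuationDynamics) hsc hν Z.currentClass

/-- **Reduction of the FGR-positivity stub to trial vectors** (the provable part of Stub 7 of line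
`separable-vertex-faddeev-pair-sector`): if for all `ν ∈ (0, ν₀)` there is `φ_ν ∈ D(𝓛♮)` with
`2⟪[J], φ_ν⟫₀ - ν‖φ_ν‖₀² - ν⁻¹‖𝓛♮φ_ν‖₀² ≥ c`, then `A_μ(ν) ≥ c` on `(0, ν₀)`. The missing
ingredient of the stub is exactly the construction of such (all-orders dressed) trial vectors with
`c > 0` for the Gibbs state of `pinnedChain` at small `T`. [folklore] -/
theorem _root_.Literature.MathematicalPhysics.KineticTheory.HeatConduction.ZeroWavenumberData.abelFunctional_floor_of_trialVectors
    (hRev : Z.HasMomentumReversal)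
    (hsc : ∀ ψ : ZeroWavenumberSpace Z, Continuous fun t : ℝ => Z.koopman t ψ) {c ν₀ : ℝ}
    (htrial : ∀ ν : ℝ, 0 < ν → ν < ν₀ → ∃ (φ : ZeroWavenumberSpace Z)
      (hφ : φ ∈ Z.toFluctuationDynamics.generatorDomain),
      c ≤ 2 * ⟪Z.currentClass, φ⟫_ℝ - ν * ‖φ‖ ^ 2 - ν⁻¹ * ‖Z.generator ⟨φ, hφ⟩‖ ^ 2) :
    ∀ ν : ℝ, 0 < ν → ν < ν₀ →
      c ≤ ∫ t in Ioi (0 : ℝ), Real.exp (-(ν * t)) * D.currentCorrelation Z.μ t :=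
  fun ν hν hν₀ => (Z.le_abelFunctional_iff hRev hsc hν c).2 (htrial ν hν hν₀)

/-- **Converse: an Abel floor yields trial vectors** (attainment): if `A_μ(ν) ≥ c` on `(0, ν₀)`
then for each such `ν` some `φ_ν ∈ D(𝓛♮)` has `2⟪[J], φ_ν⟫₀ - ν‖φ_ν‖₀² - ν⁻¹‖𝓛♮φ_ν‖₀² ≥ c`.
[folklore] -/
theorem _root_.Literature.MathematicalPhysics.KineticTheory.HeatConduction.ZeroWavenumberData.trialVectors_of_abelFunctional_floor
    (hRev : Z.HasMomentumReversal)
    (hsc : ∀ ψ : ZeroWavenumberSpace Z, Continuous fun t : ℝ => Z.koopman t ψ) {c ν₀ : ℝ}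
    (hfloor : ∀ ν : ℝ, 0 < ν → ν < ν₀ →
      c ≤ ∫ t in Ioi (0 : ℝ), Real.exp (-(ν * t)) * D.currentCorrelation Z.μ t) :
    ∀ ν : ℝ, 0 < ν → ν < ν₀ → ∃ (φ : ZeroWavenumberSpace Z)
      (hφ : φ ∈ Z.toFluctuationDynamics.generatorDomain),
      c ≤ 2 * ⟪Z.currentClass, φ⟫_ℝ - ν * ‖φ‖ ^ 2 - ν⁻¹ * ‖Z.generator ⟨φ, hφ⟩‖ ^ 2 :=
  fun ν hν hν₀ => (Z.le_abelFunctional_iff hRev hsc hν c).1 (hfloor ν hν hν₀)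

/-- **The uniform Abel floor of Stub 7 is EQUIVALENT to the existence of trial vectors** (at fixed
zero-wavenumber data with momentum reversal and a strongly continuous Koopman group):
`(∀ ν ∈ (0,ν₀), c ≤ A_μ(ν)) ↔ (∀ ν ∈ (0,ν₀), ∃ φ_ν ∈ D(𝓛♮), c ≤ 2⟪[J],φ_ν⟫₀ - ν‖φ_ν‖₀² - ν⁻¹‖𝓛♮φ_ν‖₀²)`.
Nothing is lost by certifying the Green–Kubo plateau through (all-orders dressed) trial vectors.
[folklore] -/
theorem _root_.Literature.MathematicalPhysics.KineticTheory.HeatConduction.ZeroWavenumberData.abelFunctional_floor_iff_trialVectors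
    (hRev : Z.HasMomentumReversal)
    (hsc : ∀ ψ : ZeroWavenumberSpace Z, Continuous fun t : ℝ => Z.koopman t ψ) (c ν₀ : ℝ) :
    (∀ ν : ℝ, 0 < ν → ν < ν₀ →
        c ≤ ∫ t in Ioi (0 : ℝ), Real.exp (-(ν * t)) * D.currentCorrelation Z.μ t) ↔
      ∀ ν : ℝ, 0 < ν → ν < ν₀ → ∃ (φ : ZeroWavenumberSpace Z)
        (hφ : φ ∈ Z.toFluctuationDynamics.generatorDomain),
        c ≤ 2 * ⟪Z.currentClass, φ⟫_ℝ - ν * ‖φ‖ ^ 2 - ν⁻¹ * ‖Z.generator ⟨φ, hφ⟩‖ ^ 2 :=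
  ⟨Z.trialVectors_of_abelFunctional_floor hRev hsc, Z.abelFunctional_floor_of_trialVectors hRev hsc⟩

/-- **Headline of this file (registered helper stub of `stmt-AtomisticToContinuum-12594`): the
uniform Abel floor of Stub 7 is equivalent to the existence of trial vectors** — for every
oscillator chain `P`, dynamics `D` and zero-wavenumber datum `Z` with momentum reversal and a
strongly continuous Koopman group, and all `c ν₀ : ℝ`:
`(∀ ν ∈ (0,ν₀), c ≤ ∫₀^∞ e^{-νt} C_μ(t) dt) ↔ (∀ ν ∈ (0,ν₀), ∃ φ ∈ D(𝓛♮), c ≤ 2⟪[J],φ⟫₀ - ν‖φ‖₀² - ν⁻¹‖𝓛♮φ‖₀²)`.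
[folklore] -/
theorem chain_abelFloor_iff_trialVectors :
    ∀ (P : Literature.MathematicalPhysics.KineticTheory.HeatConduction.OscillatorChain)
      (D : Literature.MathematicalPhysics.KineticTheory.HeatConduction.InfiniteChainDynamics P)
      (Z : Literature.MathematicalPhysics.KineticTheory.HeatConduction.ZeroWavenumberData P D),
      Z.HasMomentumReversal →
      (∀ ψ : Literature.MathematicalPhysics.KineticTheory.HeatConduction.ZeroWavenumberSpace Z,
        Continuous fun t : ℝ => Z.koopman t ψ) →
      ∀ c ν₀ : ℝ,
        (∀ ν : ℝ, 0 < ν → ν < ν₀ →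
            c ≤ MeasureTheory.integral (MeasureTheory.volume.restrict (Set.Ioi (0:ℝ)))
              (fun t : ℝ => Real.exp (-(ν * t)) * D.currentCorrelation Z.μ t)) ↔
          ∀ ν : ℝ, 0 < ν → ν < ν₀ →
            ∃ (φ : Literature.MathematicalPhysics.KineticTheory.HeatConduction.ZeroWavenumberSpace Z)
              (hφ : φ ∈ Z.toFluctuationDynamics.generatorDomain),
              c ≤ 2 * ⟪Z.currentClass, φ⟫_ℝ - ν * ‖φ‖ ^ 2 - ν⁻¹ * ‖Z.generator ⟨φ, hφ⟩‖ ^ 2 := by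
  intro P D Z hRev hsc c ν₀
  exact Z.abelFunctional_floor_iff_trialVectors hRev hsc c ν₀

end Chain

end Summit.AtomisticToContinuum.FouriersLaw.Theorems.MourreDissolution

end
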